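import Mathlib.Algebra.Order.Field.Basic
import Mathlib.Algebra.Order.BigOperators.Group.Finset
import Mathlib.Tactic.Ring
import Mathlib.Tactic.Linarith
import Mathlib.Tactic.Positivity
import Mathlib.Tactic.FieldSimp
import Summits.Ventures.CertifiedArithmetic.LowPrec.SRTree
import HarnessLib

/-!
# Stochastic rounding into a finite format, V: mean, variance and envelopes in ANY order

HONEST FRAMING: certified error envelopes and provably optimal rounding/accumulation schemes for
low-precision formats under stated cost models; every table by two implementations; no hardware or
vendor claims.

For the SR evaluation of an arbitrary summation tree `T` (model and notation: `SRTree`), with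
`m = T.nodes` the number of roundings (`= #leaves − 1`, the same for every order):

* `treeExp_id` — **UNCONDITIONAL mean decomposition** `E[ŝ_T] = ∑ leaves + treeBias`, and
  `treeExp_id_of_noSatT` — `E[ŝ_T] = ∑ leaves` for EVERY order when no node saturates
  (`NoSatT`; without it the statement is false already for one node: `SRStep`);
* `treeExp_sq_sub` — **EXACT variance identity** `E[(ŝ_T − a)²] = treeVar + (∑ leaves − a)²`
  (orthogonality of the mean-independent increments ACROSS independent subtrees);
* `treeVar_le` — envelope `treeVar ≤ m · G²/4` under `GapLET G`, the SAME for every order (in this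
  absolute, fixed-spacing model the order changes the exact variance but not the envelope);
  `treeVar_le_of_succ`: on any format whose spacing is `≤ G` this holds for all trees and all (not
  necessarily representable) leaves; `treeVar_le_of_mem`: pair-table form for format-valued leaves;
* `tree_prob_dev_ge_le` — Bienaymé–Chebyshev `P(|ŝ_T − ∑| ≥ t) ≤ m G²/(4t²)`;
  `allOut_abs_sub_le` — the sure bound `|ŝ_T − ∑| ≤ m·G`;
* `treeExp_comb` — the left comb is recursive summation: `treeExp F (comb x s n) = accExp F x n · s`
  (consistency with `SRAccumulation`, via the last-step decomposition `accExp_succ_last`), with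
  `nodes_comb`, `exact_comb`, `allOut_comb_iff`.

Placement: see `SRTree` (relative-model pairwise results doi:10.1137/23m1563001, arXiv:2411.13601
Thm 4.1; the finite-format identities and envelopes in `m` are this venture's additions).
-/

namespace Summit.Ventures.CertifiedArithmetic.LowPrec.SR

open Literature.ComputerArithmetic.ConnollyHighamMary2021
open Finset STree

variable {K : Type*} [Field K] [LinearOrder K] [IsStrictOrderedRing K]

/-! ### Mean: exact decomposition; unbiasedness for every order without saturation -/

omit [IsStrictOrderedRing K] in
/-- **Mean decomposition (unconditional, any order).** `E[ŝ_T] = ∑ leaves + treeBias`: the only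
source of bias in SR summation into a finite format, in ANY order, is saturation. -/
theorem treeExp_id (F : Finset K) : ∀ t : STree K,
    treeExp F t (fun v => v) = t.exact + treeBias F t
  | .leaf x => by simp [treeExp, STree.exact, treeBias]
  | .node l r => by
      simp only [treeExp, STree.exact, treeBias]
      have h1 : ∀ a, treeExp F r (fun b => step F (a + b) (fun v => v))
          = a + (r.exact + treeBias F r) + treeExp F r (fun b => clamp F (a + b) - (a + b)) := by
        intro a
        rw [treeExp_congr F r (g := fun b => (a + b) + (clamp F (a + b) - (a + b)))
          (fun b => by rw [step_id]; ring)]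
        rw [treeExp_add F r (fun b => a + b) (fun b => clamp F (a + b) - (a + b))]
        rw [treeExp_congr F r (f := fun b => a + b) (g := fun b => b + a) (fun b => add_comm a b)]
        rw [treeExp_add_const F r (fun b => b) a, treeExp_id F r]
        ring
      rw [treeExp_congr F l h1]
      rw [treeExp_add F l (fun a => a + (r.exact + treeBias F r))
        (fun a => treeExp F r (fun b => clamp F (a + b) - (a + b)))]
      rw [treeExp_add_const F l (fun a => a) _, treeExp_id F l]
      ring

omit [IsStrictOrderedRing K] in
/-- Without a saturating node the expected saturation defect vanishes. -/
theorem treeBias_eq_zero_of_noSatT (F : Finset K) : ∀ t : STree K, NoSatT F t → treeBias F t = 0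
  | .leaf _, _ => rfl
  | .node l r, ⟨hl, hr, hh⟩ => by
      simp only [treeBias]
      rw [treeBias_eq_zero_of_noSatT F l hl, treeBias_eq_zero_of_noSatT F r hr]
      have h0 : treeExp F l (fun a => treeExp F r (fun b => clamp F (a + b) - (a + b)))
          = treeExp F l (fun _ => (0 : K)) := by
        refine treeExp_congr_of_allOut F l (allOut_mono F l (fun a ha => ?_) hh)
        rw [← treeExp_const F r (0 : K)]
        exact treeExp_congr_of_allOut F r (allOut_mono F r
          (fun b hb => by rw [clamp_eq_self hb, sub_self]) ha)
      rw [h0, treeExp_const]; ring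

omit [IsStrictOrderedRing K] in
/-- **Unbiasedness of SR summation in ANY order** (finite-format form): if no node saturates on any
branch, `E[ŝ_T] = ∑ leaves` exactly — every tree, subnormal spacing, ties, any word length. -/
theorem treeExp_id_of_noSatT (F : Finset K) (t : STree K) (h : NoSatT F t) :
    treeExp F t (fun v => v) = t.exact := by
  rw [treeExp_id, treeBias_eq_zero_of_noSatT F t h, add_zero]

/-! ### Variance: the exact identity for every order -/

/-- **Exact variance identity (any order).** Without saturation, for every centre `a`,
`E[(ŝ_T − a)²] = treeVar + (∑ leaves − a)²`; with `a = ∑ leaves`: `Var[ŝ_T] = ∑_{nodes} E[v_F(c)]`.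
The cross terms vanish by mean independence of each node's increment from everything computed
before it, including the independent sibling subtree. -/
theorem treeExp_sq_sub (F : Finset K) : ∀ t : STree K, NoSatT F t → ∀ a : K,
    treeExp F t (fun v => (v - a) ^ 2) = treeVar F t + (t.exact - a) ^ 2
  | .leaf x, _, a => by simp [treeExp, treeVar, STree.exact]
  | .node l r, ⟨hl, hr, hh⟩, a => by
      simp only [treeExp, treeVar, STree.exact]
      -- one step at the node: second moment splits (step_sq_add), clamp = id on the support
      have h1 : treeExp F l (fun a' => treeExp F r (fun b => step F (a' + b) (fun v => (v - a) ^ 2)))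
          = treeExp F l (fun a' => treeExp F r (fun b =>
              srVar F (clamp F (a' + b)) + (b - (a - a')) ^ 2)) := by
        refine treeExp_congr_of_allOut F l (allOut_mono F l (fun a' ha => ?_) hh)
        refine treeExp_congr_of_allOut F r (allOut_mono F r (fun b hb => ?_) ha)
        rw [step_congr F _ (g := fun v => (v + -a) ^ 2) (by simp [sub_eq_add_neg])
          (by simp [sub_eq_add_neg]), step_sq_add, clamp_eq_self hb]
        ring
      rw [h1]
      have h2 : ∀ a', treeExp F r (fun b => srVar F (clamp F (a' + b)) + (b - (a - a')) ^ 2)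
          = treeExp F r (fun b => srVar F (clamp F (a' + b)))
            + (a' - (a - r.exact)) ^ 2 + treeVar F r := by
        intro a'
        rw [treeExp_add F r, treeExp_sq_sub F r hr]; ring
      rw [treeExp_congr F l h2, treeExp_add F l, treeExp_add F l, treeExp_const,
        treeExp_sq_sub F l hl]
      ring

/-- The variance about the exact sum. -/
theorem treeExp_sq_sub_exact (F : Finset K) (t : STree K) (h : NoSatT F t) :
    treeExp F t (fun v => (v - t.exact) ^ 2) = treeVar F t := by
  rw [treeExp_sq_sub F t h, sub_self, zero_pow two_ne_zero, add_zero]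

/-! ### Envelopes: `treeVar ≤ m · G²/4`, `m` = number of roundings, for every order -/

/-- **Variance growth (any order).** If every node's pre-rounding value has candidate gap `≤ G` on
every branch, `treeVar ≤ m·G²/4` with `m = T.nodes` (`=` leaves `− 1`). -/
theorem treeVar_le (F : Finset K) (G : K) : ∀ t : STree K, GapLET F G t →
    treeVar F t ≤ t.nodes * G ^ 2 / 4
  | .leaf _, _ => by simp [treeVar, STree.nodes]
  | .node l r, ⟨hl, hr, hg⟩ => by
      simp only [treeVar, STree.nodes]
      have h1 : treeExp F l (fun a => treeExp F r (fun b => srVar F (clamp F (a + b)))) ≤ G ^ 2 / 4 := by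
        refine treeExp_le_of_allOut F l (allOut_mono F l (fun a ha => ?_) hg)
        refine treeExp_le_of_allOut F r (allOut_mono F r (fun b hb => ?_) ha)
        refine (srVar_le_gap_sq_div_four F _).trans ?_
        have h0 : 0 ≤ roundUp F (clamp F (a + b)) - roundDown F (clamp F (a + b)) :=
          sub_nonneg.mpr (roundDown_le_roundUp F _)
        have := mul_self_le_mul_self h0 hb
        nlinarith [this]
      have h2 := treeVar_le F G l hl
      have h3 := treeVar_le F G r hr
      push_cast
      linarith

/-- `GapLET G` for ALL trees (arbitrary leaves) once `G ≥ 0` bounds the spacing of `F`. -/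
theorem gapLET_of_succ {F : Finset K} (hF : F.Nonempty) {G : K} (hG : 0 ≤ G)
    (hsucc : ∀ a ∈ F, a < F.max' hF → ∃ b ∈ F, a < b ∧ b ≤ a + G) :
    ∀ t : STree K, GapLET F G t
  | .leaf _ => trivial
  | .node l r => ⟨gapLET_of_succ hF hG hsucc l, gapLET_of_succ hF hG hsucc r,
      allOut_of_forall F l (fun _ => allOut_of_forall F r
        (fun _ => gap_le_of_succ hF hG hsucc (clamp_inHull hF _)))⟩

/-- **Any-order variance envelope from the maximal spacing**: `treeVar ≤ m G²/4` for EVERY tree and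
all leaves, on any format whose spacing is `≤ G`. -/
theorem treeVar_le_of_succ {F : Finset K} (hF : F.Nonempty) {G : K} (hG : 0 ≤ G)
    (hsucc : ∀ a ∈ F, a < F.max' hF → ∃ b ∈ F, a < b ∧ b ≤ a + G) (t : STree K) :
    treeVar F t ≤ t.nodes * G ^ 2 / 4 :=
  treeVar_le F G t (gapLET_of_succ hF hG hsucc t)

/-- `LeavesIn F T`: every leaf is a format value. -/
def LeavesIn (F : Finset K) : STree K → Prop
  | .leaf x => x ∈ F
  | .node l r => LeavesIn F l ∧ LeavesIn F r

omit [IsStrictOrderedRing K] in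
/-- With format-valued leaves, every possible value of `ŝ_T` is a format value. -/
theorem allOut_mem_of_leavesIn {F : Finset K} (hF : F.Nonempty) : ∀ t : STree K,
    LeavesIn F t → AllOut F t (fun v => v ∈ F)
  | .leaf _, h => h
  | .node l r, _ => allOut_mem_node F hF l r

omit [IsStrictOrderedRing K] in
/-- Node-wise gap bound from a PAIR table, for format-valued leaves: every pre-rounding value is
then a sum of two format values. -/
theorem gapLET_of_mem {F : Finset K} (hF : F.Nonempty) (G : K)
    (hG : ∀ a ∈ F, ∀ b ∈ F, roundUp F (clamp F (a + b)) - roundDown F (clamp F (a + b)) ≤ G) :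
    ∀ t : STree K, LeavesIn F t → GapLET F G t
  | .leaf _, _ => trivial
  | .node l r, ⟨hl, hr⟩ => ⟨gapLET_of_mem hF G hG l hl, gapLET_of_mem hF G hG r hr,
      allOut_mono F l (fun a ha => allOut_mono F r (fun b hb => hG a ha b hb)
        (allOut_mem_of_leavesIn hF r hr)) (allOut_mem_of_leavesIn hF l hl)⟩

/-- **Any-order variance envelope from the pair table**: if `v_F(clamp(a + b)) ≤ V` for all format
values `a, b`, then `treeVar ≤ m·V` for every tree with format-valued leaves (no saturation
hypothesis). -/
theorem treeVar_le_of_mem {F : Finset K} (hF : F.Nonempty) (V : K)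
    (hV : ∀ a ∈ F, ∀ b ∈ F, srVar F (clamp F (a + b)) ≤ V) :
    ∀ t : STree K, LeavesIn F t → treeVar F t ≤ t.nodes * V
  | .leaf _, _ => by simp [treeVar, STree.nodes]
  | .node l r, ⟨hl, hr⟩ => by
      simp only [treeVar, STree.nodes]
      have h1 : treeExp F l (fun a => treeExp F r (fun b => srVar F (clamp F (a + b)))) ≤ V :=
        treeExp_le_of_allOut F l (allOut_mono F l (fun a ha =>
          treeExp_le_of_allOut F r (allOut_mono F r (fun b hb => hV a ha b hb)
            (allOut_mem_of_leavesIn hF r hr))) (allOut_mem_of_leavesIn hF l hl))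
      have h2 := treeVar_le_of_mem hF V hV l hl
      have h3 := treeVar_le_of_mem hF V hV r hr
      push_cast
      linarith

/-! ### Chebyshev: the `√m` probabilistic bound; the sure linear bound -/

/-- **Chebyshev from the exact variance (any order)**: without saturation,
`P(|ŝ_T − ∑ leaves| ≥ t) ≤ treeVar / t²`. -/
theorem tree_prob_dev_ge_le_treeVar (F : Finset K) (T : STree K) (h : NoSatT F T) {t : K}
    (ht : 0 < t) : treeExp F T (devInd t T.exact) ≤ treeVar F T / t ^ 2 := by
  calc treeExp F T (devInd t T.exact)
      ≤ treeExp F T (fun v => (1 / t ^ 2) * (v - T.exact) ^ 2) :=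
        treeExp_mono F T (fun v => by rw [one_div_mul_eq_div]; exact devInd_le_sq_div t _ v ht)
    _ = treeVar F T / t ^ 2 := by
        rw [treeExp_mul_left, treeExp_sq_sub_exact F T h]; ring

/-- **The `√m` law (any order)**: without saturation and with node gaps `≤ G`,
`P(|ŝ_T − ∑ leaves| ≥ t) ≤ m G²/(4t²)`, `m` = number of roundings. -/
theorem tree_prob_dev_ge_le (F : Finset K) (G : K) (T : STree K) (h : NoSatT F T)
    (hg : GapLET F G T) {t : K} (ht : 0 < t) :
    treeExp F T (devInd t T.exact) ≤ T.nodes * G ^ 2 / (4 * t ^ 2) := by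
  refine (tree_prob_dev_ge_le_treeVar F T h ht).trans ?_
  rw [div_le_div_iff₀ (by positivity) (by positivity)]
  have := treeVar_le F G T hg
  have ht2 : 0 < t ^ 2 := by positivity
  nlinarith

/-- **Sure bound (any order)**: without saturation and with node gaps `≤ G`, every possible value
satisfies `|ŝ_T − ∑ leaves| ≤ m·G` (linear in the number of roundings; contrast with `√m`). -/
theorem allOut_abs_sub_le (F : Finset K) (G : K) : ∀ T : STree K, NoSatT F T → GapLET F G T →
    AllOut F T (fun v => |v - T.exact| ≤ T.nodes * G)
  | .leaf x, _, _ => by simp [AllOut, STree.exact, STree.nodes]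
  | .node l r, ⟨hl, hr, hh⟩, ⟨hgl, hgr, hg⟩ => by
      simp only [AllOut, STree.exact, STree.nodes]
      have ihl := allOut_abs_sub_le F G l hl hgl
      have ihr := allOut_abs_sub_le F G r hr hgr
      have hboth := allOut_and F l (allOut_and F l hh hg) ihl
      refine allOut_mono F l (fun a ha => ?_) hboth
      obtain ⟨⟨hha, hga⟩, hla⟩ := ha
      have hboth' := allOut_and F r (allOut_and F r hha hga) ihr
      refine allOut_mono F r (fun b hb => ?_) hboth'
      obtain ⟨⟨hhb, hgb⟩, hrb⟩ := hb
      rw [clamp_eq_self hhb] at hgb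
      have hu1 := le_roundUp F (a + b)
      have hd1 := roundDown_le F (a + b)
      have hla' := (abs_le.mp hla)
      have hrb' := (abs_le.mp hrb)
      simp only [up, dn, clamp_eq_self hhb]
      push_cast
      constructor
      · rw [abs_le]; constructor <;> nlinarith
      · rw [abs_le]; constructor <;> nlinarith

/-! ### The left comb is recursive summation (consistency with file II) -/

omit [IsStrictOrderedRing K] in
/-- Last-step decomposition of recursive summation: `E_s[f(ŝₙ₊₁)] = E_s[(step F (· + xₙ) f)(ŝₙ)]`. -/
theorem accExp_succ_last (F : Finset K) : ∀ (n : ℕ) (x : ℕ → K) (f : K → K) (s : K),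
    accExp F x (n + 1) f s = accExp F x n (fun a => step F (a + x n) f) s
  | 0, x, f, s => rfl
  | n + 1, x, f, s => by
      simp only [accExp]
      congr 1
      funext a
      exact accExp_succ_last F n (fun i => x (i + 1)) f a

omit [IsStrictOrderedRing K] in
/-- **The left comb is recursive summation**: `E[f(ŝ_{comb x s n})] = accExp F x n f s`. -/
theorem treeExp_comb (F : Finset K) (x : ℕ → K) (s : K) : ∀ (n : ℕ) (f : K → K),
    treeExp F (comb x s n) f = accExp F x n f s
  | 0, f => rfl
  | n + 1, f => by
      rw [comb, treeExp, accExp_succ_last]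
      exact treeExp_comb F x s n _

omit [Field K] [LinearOrder K] [IsStrictOrderedRing K] in
/-- The comb has `n` roundings. -/
theorem nodes_comb (x : ℕ → K) (s : K) : ∀ n : ℕ, (comb x s n).nodes = n
  | 0 => rfl
  | n + 1 => by rw [comb, STree.nodes, nodes_comb x s n]; rfl

omit [LinearOrder K] [IsStrictOrderedRing K] in
/-- The comb's exact sum is `s + ∑_{i<n} xᵢ`. -/
theorem exact_comb (x : ℕ → K) (s : K) : ∀ n : ℕ, (comb x s n).exact = s + ∑ i ∈ range n, x i
  | 0 => by simp [comb, STree.exact]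
  | n + 1 => by rw [comb, STree.exact, exact_comb x s n, sum_range_succ, STree.exact]; ring

omit [IsStrictOrderedRing K] in
/-- Last-step form of file II's `AllOutcomes`. -/
theorem allOutcomes_succ_last (F : Finset K) : ∀ (n : ℕ) (x : ℕ → K) (P : K → Prop) (s : K),
    AllOutcomes F x (n + 1) P s ↔
      AllOutcomes F x n (fun a => P (up F (a + x n)) ∧ P (dn F (a + x n))) s
  | 0, x, P, s => Iff.rfl
  | n + 1, x, P, s => by
      rw [AllOutcomes, allOutcomes_succ_last F n (fun i => x (i + 1)) P,
        allOutcomes_succ_last F n (fun i => x (i + 1)) P, AllOutcomes]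

omit [IsStrictOrderedRing K] in
/-- The comb's support predicate is file II's path predicate `AllOutcomes`. -/
theorem allOut_comb_iff (F : Finset K) (x : ℕ → K) (s : K) : ∀ (n : ℕ) (P : K → Prop),
    AllOut F (comb x s n) P ↔ AllOutcomes F x n P s
  | 0, P => Iff.rfl
  | n + 1, P => by
      rw [comb, AllOut, allOut_comb_iff F x s n, allOutcomes_succ_last]
      rfl


end Summit.Ventures.CertifiedArithmetic.LowPrec.SR
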